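import Summits.BirchSwinnertonDyer.BirchSwinnertonDyer.Theorems.ClassRecordThreeCornerAtThreeBranchesDefs
import Summits.BirchSwinnertonDyer.BirchSwinnertonDyer.Theorems.ClassRecordThreeCornerAtThreeUpperShimuraDefs
import Literature.NumberTheory.EllipticCurves.SteinWuthrich2013.MultiplicativeLeadingTerm
import Literature.NumberTheory.EllipticCurves.Kato2004.IwasawaCohomology
import Literature.NumberTheory.EllipticCurves.Kato2004.DivisibilityInputsMultiplicative
import Literature.NumberTheory.EllipticCurves.Kato2004.DivisibilityInputsMultiplicativeFine
import Literature.NumberTheory.EllipticCurves.Greenberg1999.SelmerCotorsionMultiplicative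
import Literature.NumberTheory.EllipticCurves.PAdicBSD
import Literature.NumberTheory.EllipticCurves.Cha2005.ShaStructureIrreducible
import Literature.NumberTheory.EllipticCurves.CuspFormLFunction
import Literature.NumberTheory.EllipticCurves.HeegnerPoints
import Literature.NumberTheory.EllipticCurves.LeadingTerm
import Literature.NumberTheory.EllipticCurves.ManinConstantSemistablePrimewise
import Literature.NumberTheory.EllipticCurves.NonvanishingTwistsHoffsteinLuo
import Literature.NumberTheory.EllipticCurves.NonvanishingTwistsPrescribedInert
import Literature.NumberTheory.GaloisCohomology.PoitouTateSelmerStructures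
import Literature.NumberTheory.GaloisCohomology.PoitouTateSha
import Literature.NumberTheory.EllipticCurves.Kato2004.IwasawaCohomologyExistsProofs
import Literature.NumberTheory.EllipticCurves.HeegnerPointsOfConductorOneGaloisConjProofs
import Literature.NumberTheory.EllipticCurves.HeegnerPointsOfConductorOneRationalityProofs
import Literature.NumberTheory.EllipticCurves.QuadraticTwistLocalDataAtTwoHoldsProofs
import HarnessLib

/-!
# Route `ClassRecordThree` (rung K2@3), crux `CornerAtThree` ∕ `CornerAtThreeW` (items stmt-BirchSwinnertonDyer-19111 ∕ 21420),
# registered skeleton `Cruxes/CornerAtThree/Lines/inert.lean` (6c4e59b5f857): the by-name fact bundle `stub_cornerFacts3`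
# DISCHARGED down to its 24 genuinely open named facts (cell `bsd-stepL`, seat `bsd-stepL-mult-p3` g5;
# `--supports stmt-BirchSwinnertonDyer-19111`)

WHY. The skeleton of record bundles, as its seventh stub `stub_cornerFacts3` («MERGED, by name; CITABLE, never proved here»),
TWENTY-EIGHT named facts: birth's thirteen Kato-twin facts, lane A's four, lane B's three, the inert road's eight. FOUR of
the twenty-eight are THEOREMS of the tree today, with `_holds` companions in Literature:
* `Kato2004.nonempty_iwasawaH1Data` (Kato 2004 §12.2 (12.2.1): `𝐇¹(T_pW)` exists) — `Kato2004.nonempty_iwasawaH1Data_holds`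
  (`Kato2004/IwasawaCohomologyExistsProofs`);
* `heegnerPointOfConductor_one_galoisConj N W K` (Shimura reciprocity at conductor `1`; Darmon 2004 Thm. 3.7 ∕ Gross 1991 §4) —
  `heegnerPointOfConductor_one_galoisConj_holds` (`HeegnerPointsOfConductorOneGaloisConjProofs`);
* `phi_heegnerTau_mem_singularModuliField N W K` (Darmon 2004 Thm. 3.6 at conductor `1`) —
  `phi_heegnerTau_mem_singularModuliField_holds` (`HeegnerPointsOfConductorOneRationalityProofs`);
* `BarriosEtAl2025.localTamagawaNumber_quadraticTwist_two_mem_of_goodReduction` (Barrios et al. 2025 Thm. 5.1, rows `I₀`) —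
  `BarriosEtAl2025.localTamagawaNumber_quadraticTwist_two_mem_of_goodReduction_holds` (`QuadraticTwistLocalDataAtTwoHoldsProofs`).
So the stub is CITABLE from the other TWENTY-FOUR alone. This file records that once, in the two shapes the line consumes:
`katoTwinFactsThreeAn_of_twelve` (the thirteen-conjunct analytic Kato-twin bundle of `cornerAtThree_of_branchesAn` — and of
g4's twist-witness engines `cornerTwistWitnessAt_of_unitTwinSupply` ∕ `…_of_exactTwinSupply` — from its twelve open facts) and
`cornerFacts3_of_openFacts` (the registered text of `stub_cornerFacts3` VERBATIM from the twenty-four open facts, in the stub's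
order). A re-homed skeleton for `CornerAtThreeW` (RULING 33 STEP 2) can cite either. HONEST FRAMING: two theorems, no definition ∕
fact ∕ sorry; nothing is asserted about any curve; no stub closes (the twenty-four facts stay OPEN named print); BSD is not advanced; T7.

PARTITION: O2@3 (B10) × T4″ corner × `stub_cornerFacts3` — proves-glue (by-name floor 28 → 24); closes: none (T7).

References: [cite: Kato2004Asterisque, §12.2 (12.2.1) (p. 220)] [cite: Darmon2004, Thm. 3.6 and Thm. 3.7 (PDF pp. 43–44)]
[cite: BarriosEtAl2025, Thm. 5.1 (arXiv:2501.03209 pp. 15–16)] [cite: GrossLMS1991, §4].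
-/

set_option linter.dupNamespace false
set_option autoImplicit false

namespace Summit.BirchSwinnertonDyer.BirchSwinnertonDyer.Theorems.CornerFactsDischarged

open scoped Classical NumberField
open CongruenceSubgroup WeierstrassCurve NumberField IsDedekindDomain Literature.NumberTheory.EllipticCurves
  Literature.NumberTheory.EllipticCurves.ModularForms Literature.NumberTheory.GaloisCohomology
  Literature.NumberTheory.EllipticCurves.Rank1Residual Literature.NumberTheory.EllipticCurves.Rank1Residual.Typed
  Literature.NumberTheory.EllipticCurves.BarriosEtAl2025 Literature.NumberTheory.Automorphic
  Summit.BirchSwinnertonDyer.Rank1Residual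
  Summit.BirchSwinnertonDyer.Rank1Residual.X11b Summit.BirchSwinnertonDyer.Rank1Residual.X11b.Three
  Summit.BirchSwinnertonDyer.BirchSwinnertonDyer.Theorems

/-- **The thirteen-conjunct analytic Kato-twin bundle from its TWELVE open facts** (conjunct 7, Kato 2004 §12.2 (12.2.1)
`nonempty_iwasawaH1Data`, is the tree theorem `Kato2004.nonempty_iwasawaH1Data_holds`). Output text = the `hF` binder of
`cornerAtThree_of_branchesAn` (p489722) ∕ conjunct 1 of `stub_cornerFacts3` VERBATIM. Bookkeeping; the twelve stay OPEN named print.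
[cite: Kato2004Asterisque, §12.2 (12.2.1) (p. 220), Thm. 12.4, §17.13] [cite: SteinWuthrich2013, Thm. 6.1] [cite: Wuthrich2014, Cor. 18] -/
theorem katoTwinFactsThreeAn_of_twelve
    (hJs : Literature.NumberTheory.EllipticCurves.SteinWuthrich2013.thm61_splitMultiplicative)
    (hJn : Literature.NumberTheory.EllipticCurves.SteinWuthrich2013.thm61_nonsplitMultiplicative)
    (hGZK : Literature.NumberTheory.EllipticCurves.rank_eq_analyticRank_of_analyticRank_le_one)
    (hmod : WeierstrassCurve.hasEntireLFunction_rat)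
    (hpar : Literature.NumberTheory.EllipticCurves.ModularForms.nonempty_modularParametrizationData)
    (hGS : ∀ (W : WeierstrassCurve ℚ) [W.IsElliptic] [W.IsGloballyMinimal] (p : ℕ) [Fact p.Prime],
      Literature.NumberTheory.EllipticCurves.greenberg_stevens W p)
    (h12 : Literature.NumberTheory.EllipticCurves.Kato2004.thm12_4)
    (hns : Literature.NumberTheory.EllipticCurves.Kato2004.exists_multDivisibilityInputs_nonsplit)
    (hsp : Literature.NumberTheory.EllipticCurves.Kato2004.exists_multDivisibilityInputs_split)
    (h15 : Literature.NumberTheory.EllipticCurves.Greenberg1999.thm15_isTorsion_multiplicative_rat)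
    (h18 : Literature.NumberTheory.EllipticCurves.Wuthrich2014.corollary18_padicLFunction_mem_iwasawaAlgebra_multiplicative)
    (hfine : Literature.NumberTheory.EllipticCurves.Kato2004.exists_multDivisibilityInputs_fine) :
    (Literature.NumberTheory.EllipticCurves.SteinWuthrich2013.thm61_splitMultiplicative ∧
      Literature.NumberTheory.EllipticCurves.SteinWuthrich2013.thm61_nonsplitMultiplicative ∧
      Literature.NumberTheory.EllipticCurves.rank_eq_analyticRank_of_analyticRank_le_one ∧
      WeierstrassCurve.hasEntireLFunction_rat ∧
      Literature.NumberTheory.EllipticCurves.ModularForms.nonempty_modularParametrizationData ∧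
      (∀ (W : WeierstrassCurve ℚ) [W.IsElliptic] [W.IsGloballyMinimal] (p : ℕ) [Fact p.Prime],
        Literature.NumberTheory.EllipticCurves.greenberg_stevens W p) ∧
      Literature.NumberTheory.EllipticCurves.Kato2004.nonempty_iwasawaH1Data ∧
      Literature.NumberTheory.EllipticCurves.Kato2004.thm12_4 ∧
      Literature.NumberTheory.EllipticCurves.Kato2004.exists_multDivisibilityInputs_nonsplit ∧
      Literature.NumberTheory.EllipticCurves.Kato2004.exists_multDivisibilityInputs_split ∧
      Literature.NumberTheory.EllipticCurves.Greenberg1999.thm15_isTorsion_multiplicative_rat ∧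
      Literature.NumberTheory.EllipticCurves.Wuthrich2014.corollary18_padicLFunction_mem_iwasawaAlgebra_multiplicative ∧
      Literature.NumberTheory.EllipticCurves.Kato2004.exists_multDivisibilityInputs_fine) :=
  ⟨hJs, hJn, hGZK, hmod, hpar, hGS, Literature.NumberTheory.EllipticCurves.Kato2004.nonempty_iwasawaH1Data_holds, h12, hns, hsp,
    h15, h18, hfine⟩

/-- **`stub_cornerFacts3` of the registered skeleton `Lines/inert.lean` (6c4e59b5f857) — its text VERBATIM — from the TWENTY-FOUR
open named facts.** The four other conjuncts are tree theorems: Kato §12.2 (12.2.1) (`Kato2004.nonempty_iwasawaH1Data_holds`),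
Shimura reciprocity at conductor `1` (`heegnerPointOfConductor_one_galoisConj_holds`), Darmon 2004 Thm. 3.6
(`phi_heegnerTau_mem_singularModuliField_holds`), Barrios et al. 2025 Thm. 5.1 (`localTamagawaNumber_quadraticTwist_two_mem_of_goodReduction_holds`).
Binders in the stub's order: Stein–Wuthrich Thm 6.1 ×2, GZK, entire L, parametrisation supply, Greenberg–Stevens, Kato Thm 12.4 ∕ §17.13 inputs
non-split ∕ split, Greenberg 1999 Thm 1.5, Wuthrich 2014 Cor 18, Kato §17.13 fine; Kolyvagin; Cha 2005 Rmk. 25; newforms; Poitou–Tate ×2;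
Gross–Zagier; Hoffstein–Luo; Mazur's Manin constant; Friedberg–Hoffstein inert twist; Jacquet–Langlands ∕ Shimura parametrisation supply;
Pasten 2024 component orders; Cai–Shu–Tian. Bookkeeping; no stub closes; the twenty-four stay OPEN named print.
[cite: Kato2004Asterisque, §12.2 (12.2.1) (p. 220)] [cite: Darmon2004, Thm. 3.6 and Thm. 3.7 (PDF pp. 43–44)]
[cite: BarriosEtAl2025, Thm. 5.1 (arXiv:2501.03209 pp. 15–16)] -/
theorem cornerFacts3_of_openFacts
    (hJs : Literature.NumberTheory.EllipticCurves.SteinWuthrich2013.thm61_splitMultiplicative)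
    (hJn : Literature.NumberTheory.EllipticCurves.SteinWuthrich2013.thm61_nonsplitMultiplicative)
    (hGZK : Literature.NumberTheory.EllipticCurves.rank_eq_analyticRank_of_analyticRank_le_one)
    (hmod : WeierstrassCurve.hasEntireLFunction_rat)
    (hpar : Literature.NumberTheory.EllipticCurves.ModularForms.nonempty_modularParametrizationData)
    (hGS : ∀ (W : WeierstrassCurve ℚ) [W.IsElliptic] [W.IsGloballyMinimal] (p : ℕ) [Fact p.Prime],
      Literature.NumberTheory.EllipticCurves.greenberg_stevens W p)
    (h12 : Literature.NumberTheory.EllipticCurves.Kato2004.thm12_4)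
    (hns : Literature.NumberTheory.EllipticCurves.Kato2004.exists_multDivisibilityInputs_nonsplit)
    (hsp : Literature.NumberTheory.EllipticCurves.Kato2004.exists_multDivisibilityInputs_split)
    (h15 : Literature.NumberTheory.EllipticCurves.Greenberg1999.thm15_isTorsion_multiplicative_rat)
    (h18 : Literature.NumberTheory.EllipticCurves.Wuthrich2014.corollary18_padicLFunction_mem_iwasawaAlgebra_multiplicative)
    (hfine : Literature.NumberTheory.EllipticCurves.Kato2004.exists_multDivisibilityInputs_fine)
    (hKo : ∀ (N : ℕ) [NeZero N] (W : WeierstrassCurve ℚ) (K : Type) [Field K] [NumberField K], kolyvagin N W K)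
    (hChaU : Cha2005.rmk25_padicValNat_card_sha_primary_add_le_of_globalDivisibility)
    (hnf : exists_isNewformOf)
    (hPT : ∀ (K : Type) [Field K] [NumberField K], poitouTate_selmerStructure_duality K)
    (hPTsha : ∀ (K : Type) [Field K] [NumberField K], poitouTate_sha_tateDual K)
    (hGZ : ∀ (N : ℕ) [NeZero N] (W : WeierstrassCurve ℚ) (K : Type) [Field K] [NumberField K], gross_zagier N W K)
    (hHL : HoffsteinLuo1997_exists_twist_L_one_ne_zero)
    (hMaz : mazur_not_dvd_maninConstant_of_odd)
    (hFH : friedbergHoffstein_exists_twist_ne_zero_inertAt)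
    (hJL : nonempty_shimuraParametrizationData)
    (hPS : PastenShimura2024_componentOrders)
    (hCST : shimuraCurve_heegnerPoint_grossZagier) :
    (Literature.NumberTheory.EllipticCurves.SteinWuthrich2013.thm61_splitMultiplicative ∧
      Literature.NumberTheory.EllipticCurves.SteinWuthrich2013.thm61_nonsplitMultiplicative ∧
      Literature.NumberTheory.EllipticCurves.rank_eq_analyticRank_of_analyticRank_le_one ∧
      WeierstrassCurve.hasEntireLFunction_rat ∧
      Literature.NumberTheory.EllipticCurves.ModularForms.nonempty_modularParametrizationData ∧
      (∀ (W : WeierstrassCurve ℚ) [W.IsElliptic] [W.IsGloballyMinimal] (p : ℕ) [Fact p.Prime],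
        Literature.NumberTheory.EllipticCurves.greenberg_stevens W p) ∧
      Literature.NumberTheory.EllipticCurves.Kato2004.nonempty_iwasawaH1Data ∧
      Literature.NumberTheory.EllipticCurves.Kato2004.thm12_4 ∧
      Literature.NumberTheory.EllipticCurves.Kato2004.exists_multDivisibilityInputs_nonsplit ∧
      Literature.NumberTheory.EllipticCurves.Kato2004.exists_multDivisibilityInputs_split ∧
      Literature.NumberTheory.EllipticCurves.Greenberg1999.thm15_isTorsion_multiplicative_rat ∧
      Literature.NumberTheory.EllipticCurves.Wuthrich2014.corollary18_padicLFunction_mem_iwasawaAlgebra_multiplicative ∧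
      Literature.NumberTheory.EllipticCurves.Kato2004.exists_multDivisibilityInputs_fine) ∧
    (∀ (N : ℕ) [NeZero N] (W : WeierstrassCurve ℚ) (K : Type) [Field K] [NumberField K], kolyvagin N W K) ∧
    (∀ (N : ℕ) [NeZero N] (W : WeierstrassCurve ℚ) (K : Type) [Field K] [NumberField K],
      heegnerPointOfConductor_one_galoisConj N W K) ∧
    (∀ (N : ℕ) [NeZero N] (W : WeierstrassCurve ℚ) (K : Type) [Field K] [NumberField K],
      phi_heegnerTau_mem_singularModuliField N W K) ∧
    Cha2005.rmk25_padicValNat_card_sha_primary_add_le_of_globalDivisibility ∧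
    exists_isNewformOf ∧
    (∀ (K : Type) [Field K] [NumberField K], poitouTate_selmerStructure_duality K) ∧
    (∀ (K : Type) [Field K] [NumberField K], poitouTate_sha_tateDual K) ∧
    (∀ (N : ℕ) [NeZero N] (W : WeierstrassCurve ℚ) (K : Type) [Field K] [NumberField K], gross_zagier N W K) ∧
    HoffsteinLuo1997_exists_twist_L_one_ne_zero ∧
    mazur_not_dvd_maninConstant_of_odd ∧
    friedbergHoffstein_exists_twist_ne_zero_inertAt ∧
    localTamagawaNumber_quadraticTwist_two_mem_of_goodReduction ∧
    nonempty_shimuraParametrizationData ∧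
    PastenShimura2024_componentOrders ∧
    shimuraCurve_heegnerPoint_grossZagier :=
  ⟨katoTwinFactsThreeAn_of_twelve hJs hJn hGZK hmod hpar hGS h12 hns hsp h15 h18 hfine, hKo,
    fun N _ W K _ _ ↦ heegnerPointOfConductor_one_galoisConj_holds N W K,
    fun N _ W K _ _ ↦ phi_heegnerTau_mem_singularModuliField_holds N W K,
    hChaU, hnf, hPT, hPTsha, hGZ, hHL, hMaz, hFH,
    BarriosEtAl2025.localTamagawaNumber_quadraticTwist_two_mem_of_goodReduction_holds, hJL, hPS, hCST⟩

end Summit.BirchSwinnertonDyer.BirchSwinnertonDyer.Theorems.CornerFactsDischarged
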